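import Summits.ValiantsHypothesis.ValiantsHypothesis.Theorems.SymPencilSdcPerFourLadder
import Summits.ValiantsHypothesis.ValiantsHypothesis.Theorems.SymPencilPerFourDetectingRadical
import Summits.ValiantsHypothesis.ValiantsHypothesis.Theorems.SymPencilPerFourCrossRadical

/-!
# Route `SymPencil` — gluing the ladder to the `7`- / `6`-dimensional trichotomies
# (`--supports` stmt-ValiantsHypothesis-5674 `SdcSuperquadratic`; rung currency only)

`SymPencilSdcPerFourLadder.le_of_noSqFamily` reduces `sdc(per_4) ≥ n` (`n ≤ 25`) to the absence
of `k`-square families on `7`- and `6`-dimensional subspaces of `Sing Z(per_4)`.  The rank counts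
`SymPencilPerFourDetectingRadical.not_sqFamily_of_detecting` (a detecting pair of rows or columns)
and `SymPencilPerFourCrossRadical.not_sqFamily_of_cross` (inside a cross `row l ∪ column c`) give
`2 dim V ≤ k + 8` in those two shapes.  Hence the STRUCTURAL statements

* `T7`: every `7`-dimensional `V ⊆ Sing Z(per_4)` has a detecting pair of rows, or of columns, or
  IS a cross (the trichotomy announced by prover val-width-5676-p2 g3, files `SymPencilBoxFourSeven*`),
* `T6`: every `6`-dimensional `V ⊆ Sing Z(per_4)` has a detecting pair of rows or columns or lies
  inside a cross (conjectural),

imply respectively `H7ₖ` for `k ≤ 5` and `H6ₖ` for `k ≤ 3`, whence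
`sdc(per_4) ≥ 23 ⟸ T7` (`twentyThree_le_of_trichotomy`) and `sdc(per_4) ≥ 25 ⟸ T7 ∧ T6`
(`twentyFive_le_of_trichotomies`) over any field of characteristic `0`.  `T7`, `T6` are taken as
HYPOTHESES here, in the exact shape of g3's statement; nothing is claimed about them.

Honest framing: conditional assemblies; no new lower bound; the crux `SdcSuperquadratic` stays open
and `VP ≠ VNP` is not moved.  No definitions, no named facts. [folklore]
-/

noncomputable section

-- single-conjunct layout: Sub = Summit, duplicated namespace component intended
set_option linter.dupNamespace false

namespace Summit.ValiantsHypothesis.ValiantsHypothesis.Theorems.SymPencilSdcPerFourTrichotomyGlue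

open MvPolynomial Module
open Literature.Computability.AlgebraicComplexity
open Summit.ValiantsHypothesis.ValiantsHypothesis.Theorems.SymPencilSdcPerFourLadder
open Summit.ValiantsHypothesis.ValiantsHypothesis.Theorems.SymPencilPerFourDetectingRadical
open Summit.ValiantsHypothesis.ValiantsHypothesis.Theorems.SymPencilPerFourCrossRadical

variable {K : Type*} [Field K] [CharZero K]

/-- **`T7 ⇒ H7ₖ` for `k ≤ 5`.**  If every `7`-dimensional subspace of `Sing Z(per_4)` has a
detecting pair of rows or columns or is a cross, then none carries a `k`-square family of
`s²`-coefficients with `k ≤ 5` (`2·7 > k + 8`). [folklore] -/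
theorem not_sqFamily_seven_of_trichotomy
    (T7 : ∀ W : Submodule K (Fin 4 × Fin 4 → K),
      (∀ x ∈ W, ∀ (r c : Fin 3 → Fin 4), Function.Injective r → Function.Injective c →
        ((Matrix.of fun i j => x (i, j)).submatrix r c).permanent = 0) →
      finrank K W = 7 →
      (∃ p q : Fin 4, p ≠ q ∧ ∀ x ∈ W, (∀ j, x (p, j) = 0) → (∀ j, x (q, j) = 0) → x = 0) ∨
      (∃ p q : Fin 4, p ≠ q ∧ ∀ x ∈ W, (∀ i, x (i, p) = 0) → (∀ i, x (i, q) = 0) → x = 0) ∨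
      (∃ l c : Fin 4, ∀ x, x ∈ W ↔ ∀ i j : Fin 4, i ≠ l → j ≠ c → x (i, j) = 0))
    {k : ℕ} (hk : k ≤ 5) (V : Submodule K (Fin 4 × Fin 4 → K))
    (hW : ∀ x ∈ V, ∀ (r c : Fin 3 → Fin 4), Function.Injective r → Function.Injective c →
      ((Matrix.of fun i j => x (i, j)).submatrix r c).permanent = 0)
    (h7 : finrank K V = 7) (c : Fin k → K) :
    ¬ (∀ u : Fin 4 × Fin 4 → K, ∃ Λ : Fin k → ((Fin 4 × Fin 4 → K) →ₗ[K] K),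
        ∀ y ∈ V, ∃ e₀ e₁ : K, ∀ s : K,
          eval (u + s • y) (perPoly (Fin 4) K) = e₀ + s * e₁ + s ^ 2 * ∑ k, c k * (Λ k y) ^ 2) := by
  have hlt : Fintype.card (Fin k) + 8 < 2 * finrank K V := by rw [Fintype.card_fin, h7]; omega
  rcases T7 V hW h7 with hr | hc | ⟨l, c₀, hX⟩
  · exact not_sqFamily_of_detecting V hW (Or.inl hr) hlt c
  · exact not_sqFamily_of_detecting V hW (Or.inr hc) hlt c
  · exact not_sqFamily_of_cross V ⟨l, c₀, fun x hx => (hX x).1 hx⟩ hlt c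

/-- **`T6 ⇒ H6ₖ` for `k ≤ 3`.**  If every `6`-dimensional subspace of `Sing Z(per_4)` has a
detecting pair of rows or columns or lies inside a cross, then none carries a `k`-square family
with `k ≤ 3` (`2·6 > k + 8`). [folklore] -/
theorem not_sqFamily_six_of_trichotomy
    (T6 : ∀ W : Submodule K (Fin 4 × Fin 4 → K),
      (∀ x ∈ W, ∀ (r c : Fin 3 → Fin 4), Function.Injective r → Function.Injective c →
        ((Matrix.of fun i j => x (i, j)).submatrix r c).permanent = 0) →
      finrank K W = 6 →
      (∃ p q : Fin 4, p ≠ q ∧ ∀ x ∈ W, (∀ j, x (p, j) = 0) → (∀ j, x (q, j) = 0) → x = 0) ∨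
      (∃ p q : Fin 4, p ≠ q ∧ ∀ x ∈ W, (∀ i, x (i, p) = 0) → (∀ i, x (i, q) = 0) → x = 0) ∨
      (∃ l c : Fin 4, ∀ x ∈ W, ∀ i j : Fin 4, i ≠ l → j ≠ c → x (i, j) = 0))
    {k : ℕ} (hk : k ≤ 3) (V : Submodule K (Fin 4 × Fin 4 → K))
    (hW : ∀ x ∈ V, ∀ (r c : Fin 3 → Fin 4), Function.Injective r → Function.Injective c →
      ((Matrix.of fun i j => x (i, j)).submatrix r c).permanent = 0)
    (h6 : finrank K V = 6) (c : Fin k → K) :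
    ¬ (∀ u : Fin 4 × Fin 4 → K, ∃ Λ : Fin k → ((Fin 4 × Fin 4 → K) →ₗ[K] K),
        ∀ y ∈ V, ∃ e₀ e₁ : K, ∀ s : K,
          eval (u + s • y) (perPoly (Fin 4) K) = e₀ + s * e₁ + s ^ 2 * ∑ k, c k * (Λ k y) ^ 2) := by
  have hlt : Fintype.card (Fin k) + 8 < 2 * finrank K V := by rw [Fintype.card_fin, h6]; omega
  rcases T6 V hW h6 with hr | hc | hX
  · exact not_sqFamily_of_detecting V hW (Or.inl hr) hlt c
  · exact not_sqFamily_of_detecting V hW (Or.inr hc) hlt c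
  · exact not_sqFamily_of_cross V hX hlt c

/-- **`sdc(per_4) ≥ 23 ⟸ T7`**: the `7`-dimensional trichotomy alone lifts the rung `21` to `23`
(`H7₃` by `not_sqFamily_seven_of_trichotomy`, `H6₁` is free). [folklore] -/
theorem twentyThree_le_of_trichotomy
    (T7 : ∀ W : Submodule K (Fin 4 × Fin 4 → K),
      (∀ x ∈ W, ∀ (r c : Fin 3 → Fin 4), Function.Injective r → Function.Injective c →
        ((Matrix.of fun i j => x (i, j)).submatrix r c).permanent = 0) →
      finrank K W = 7 →
      (∃ p q : Fin 4, p ≠ q ∧ ∀ x ∈ W, (∀ j, x (p, j) = 0) → (∀ j, x (q, j) = 0) → x = 0) ∨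
      (∃ p q : Fin 4, p ≠ q ∧ ∀ x ∈ W, (∀ i, x (i, p) = 0) → (∀ i, x (i, q) = 0) → x = 0) ∨
      (∃ l c : Fin 4, ∀ x, x ∈ W ↔ ∀ i j : Fin 4, i ≠ l → j ≠ c → x (i, j) = 0))
    {m : ℕ} {A : Matrix (Fin m) (Fin m) (MvPolynomial (Fin 4 × Fin 4) K)} (hS : A.IsSymm)
    (hA : IsAffineDetRepr (perPoly (Fin 4) K) A) : 23 ≤ m :=
  twentyThree_le_of_seven
    (fun V hW h7 c => not_sqFamily_seven_of_trichotomy T7 (by norm_num) V hW h7 c) hS hA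

/-- **`sdc(per_4) ≥ 25 ⟸ T7 ∧ T6`** — the ceiling of the radical method (`H7₅`, `H6₃`). [folklore] -/
theorem twentyFive_le_of_trichotomies
    (T7 : ∀ W : Submodule K (Fin 4 × Fin 4 → K),
      (∀ x ∈ W, ∀ (r c : Fin 3 → Fin 4), Function.Injective r → Function.Injective c →
        ((Matrix.of fun i j => x (i, j)).submatrix r c).permanent = 0) →
      finrank K W = 7 →
      (∃ p q : Fin 4, p ≠ q ∧ ∀ x ∈ W, (∀ j, x (p, j) = 0) → (∀ j, x (q, j) = 0) → x = 0) ∨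
      (∃ p q : Fin 4, p ≠ q ∧ ∀ x ∈ W, (∀ i, x (i, p) = 0) → (∀ i, x (i, q) = 0) → x = 0) ∨
      (∃ l c : Fin 4, ∀ x, x ∈ W ↔ ∀ i j : Fin 4, i ≠ l → j ≠ c → x (i, j) = 0))
    (T6 : ∀ W : Submodule K (Fin 4 × Fin 4 → K),
      (∀ x ∈ W, ∀ (r c : Fin 3 → Fin 4), Function.Injective r → Function.Injective c →
        ((Matrix.of fun i j => x (i, j)).submatrix r c).permanent = 0) →
      finrank K W = 6 →
      (∃ p q : Fin 4, p ≠ q ∧ ∀ x ∈ W, (∀ j, x (p, j) = 0) → (∀ j, x (q, j) = 0) → x = 0) ∨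
      (∃ p q : Fin 4, p ≠ q ∧ ∀ x ∈ W, (∀ i, x (i, p) = 0) → (∀ i, x (i, q) = 0) → x = 0) ∨
      (∃ l c : Fin 4, ∀ x ∈ W, ∀ i j : Fin 4, i ≠ l → j ≠ c → x (i, j) = 0))
    {m : ℕ} {A : Matrix (Fin m) (Fin m) (MvPolynomial (Fin 4 × Fin 4) K)} (hS : A.IsSymm)
    (hA : IsAffineDetRepr (perPoly (Fin 4) K) A) : 25 ≤ m :=
  twentyFive_le_of
    (fun V hW h7 c => not_sqFamily_seven_of_trichotomy T7 (by norm_num) V hW h7 c)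
    (fun V hW h6 c => not_sqFamily_six_of_trichotomy T6 (by norm_num) V hW h6 c) hS hA

end Summit.ValiantsHypothesis.ValiantsHypothesis.Theorems.SymPencilSdcPerFourTrichotomyGlue

end
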